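import Summits.PneNP.PneNP.Theorems.SoloInformedIOShape
import Literature.Computability.Complexity.SparseHardSets
import Literature.Barriers.PneNP.MCSPHardnessObstructions
import Literature.Barriers.PneNP.RelativizationSparse
import HarnessLib

/-!
# Solo (informed) — the density margin: `P ≠ NP` iff no `NP`-hard set is sparse or `P`-close

Summit-side corollaries of the Literature reproduction
`Literature/Computability/Complexity/SparseHardSets.lean` (Mahaney 1982; Ogiwara–Watanabe 1991,
`1`-tt case), stated with the tree's sparseness predicate
`Literature.Barriers.PneNP.IsSparseLanguage` (`|L ∩ {0,1}ⁿ| ≤ n^c + c`):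

* `soloInformed_census_of_isSparseLanguage` — a sparse language has a cumulative polynomial census
  (the bridge from `IsSparseLanguage` to the census hypothesis of the Literature file);
* `soloInformed_pneNP_iff_no_sparse_hard_set` — `PneNP ↔` no Karp-`NP`-hard set is sparse;
* `soloInformed_pneNP_iff_no_P_close_hard_set` — `PneNP ↔` for every `NP`-hard `T` and every
  `D ∈ P`, the disagreement set `{u | u ∈ T ↔ u ∉ D}` is not sparse (no `NP`-hard set is `P`-close);
* `soloInformed_pneNP_iff_sat_errors_not_sparse` — `PneNP ↔` every polynomial-time `D` errs on
  `SAT` on a non-sparse set of formulas;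
* `soloInformed_pneNP_iff_no_tally_hard_set` — `PneNP ↔` no Karp-`NP`-hard set is tally (`⊆ 0*`;
  P. Berman 1978, via `IsTally.isSparseLanguage`).

Place in the solo programme's *sharpest statement*: `soloInformed_pneNP_iff_sat_infinitely_often_wrong`
(in `SoloInformedIOShape`) says a proof of `P ≠ NP` must exhibit, for every polynomial-time `D`,
infinitely many errors on `SAT`; the present file raises the floor to *super-polynomially many errors
up to length `n`, for infinitely many `n`* — any heuristic wrong only on a sparse set would already
give `P = NP`. The converse directions are elementary (`{ε}` is sparse and `NP`-hard when `P = NP`;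
`SAT △ SAT = ∅`).
-/

namespace Summit.PneNP.PneNP.Theorems

open Literature.Computability.Complexity Literature.Barriers.PneNP Polynomial
open scoped Literature.Computability.Complexity.Notation

/-- **Census of a sparse language.** A sparse language (`|S ∩ {0,1}ᵏ| ≤ k^c + c`) has a cumulative
polynomial census: a finset of at most `(n+1)(n^c + c)` words containing every member of length
`≤ n`. [folklore] -/
theorem soloInformed_census_of_isSparseLanguage {S : Language Bool} (hS : IsSparseLanguage S) :
    ∃ q : Polynomial ℕ, ∀ n, ∃ C : Finset (List Bool), C.card ≤ q.eval n ∧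
      ∀ u ∈ S, u.length ≤ n → u ∈ C := by
  classical
  obtain ⟨c, hc⟩ := hS
  refine ⟨(X + 1) * (X ^ c + Polynomial.C c), fun n => ?_⟩
  refine ⟨(Finset.range (n + 1)).biUnion fun k => (finite_slice S k).toFinset, ?_, ?_⟩
  · calc ((Finset.range (n + 1)).biUnion fun k => (finite_slice S k).toFinset).card
          ≤ ∑ k ∈ Finset.range (n + 1), (finite_slice S k).toFinset.card := Finset.card_biUnion_le
      _ ≤ ∑ k ∈ Finset.range (n + 1), (n ^ c + c) := Finset.sum_le_sum fun k hk => by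
          rw [← Set.ncard_eq_toFinset_card _ (finite_slice S k)]
          refine (hc k).trans ?_
          have hk' : k ≤ n := Nat.lt_succ_iff.1 (Finset.mem_range.1 hk)
          exact Nat.add_le_add_right (Nat.pow_le_pow_left hk' c) c
      _ = (n + 1) * (n ^ c + c) := by rw [Finset.sum_const, Finset.card_range, smul_eq_mul]
      _ = _ := by simp [eval_add, eval_mul, eval_pow, eval_X, eval_one]
  · intro u hu hlen
    refine Finset.mem_biUnion.2 ⟨u.length, Finset.mem_range.2 (by omega), ?_⟩
    exact (finite_slice S u.length).mem_toFinset.2 ⟨hu, rfl⟩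

/-- The one-word language `{ε}` is sparse. [folklore] -/
theorem soloInformed_isSparseLanguage_singleton_nil :
    IsSparseLanguage ({u | u = []} : Language Bool) := by
  refine ⟨1, fun n => ?_⟩
  have hsub : {x : List Bool | x ∈ ({u | u = []} : Language Bool) ∧ x.length = n} ⊆ {[]} :=
    fun x hx => by
      have hx' : x = [] := hx.1
      simp [hx']
  calc _ ≤ ({[]} : Set (List Bool)).ncard := Set.ncard_le_ncard hsub (Set.finite_singleton _)
    _ = 1 := Set.ncard_singleton _
    _ ≤ n ^ 1 + 1 := by omega

/-- **Density margin, Mahaney form.** `P ≠ NP` iff no `NP`-hard set (Karp) is sparse — by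
Mahaney's theorem (`Literature…NP_subset_P_of_isHard_of_sparse`) one way, and the sparse set `{ε}`,
`NP`-hard when `P = NP`, the other. [cite: Mahaney1982, Thm. 3.1 and the remark following it (sparse NP-complete / NP-hard set ⇒ P = NP); held: `paper:doi-10-1016-0022-0000-82-90002-2` p.5 (JCSS 25, p.134)] -/
theorem soloInformed_pneNP_iff_no_sparse_hard_set :
    PneNP ↔ ∀ T : Language Bool, IsHard Nondeterministic.NP T → ¬ IsSparseLanguage T := by
  rw [soloInformed_pneNP_iff_exists_not_mem]
  constructor
  · rintro ⟨L, hL, hLP⟩ T hT hS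
    exact hLP (NP_subset_P_of_isHard_of_sparse hT (soloInformed_census_of_isSparseLanguage hS) hL)
  · intro h
    by_contra hne
    simp only [not_exists, not_and, not_not] at hne
    exact h _ (isHard_singleton_nil_of_NP_subset_P fun L hL => hne L hL)
      soloInformed_isSparseLanguage_singleton_nil

/-- **Density margin, `P`-closeness form (Ogiwara–Watanabe, 1-tt).** `P ≠ NP` iff no `NP`-hard set
is `P`-close: for every `NP`-hard `T` and every `D ∈ P`, the set of words on which `T` and `D`
differ is not sparse. [cite: OgiwaraWatanabe1991, main theorem (≤ᵖ_btt-hard sparse sets for NP ⇒ P = NP; theorem number not verified: source not held)] -/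
theorem soloInformed_pneNP_iff_no_P_close_hard_set :
    PneNP ↔ ∀ T D : Language Bool, IsHard Nondeterministic.NP T → D ∈ Classes.P →
      ¬ IsSparseLanguage {u | u ∈ T ↔ u ∉ D} := by
  rw [soloInformed_pneNP_iff_exists_not_mem]
  constructor
  · rintro ⟨L, hL, hLP⟩ T D hT hD hS
    refine hLP (NP_subset_P_of_isHard_of_sparse_symmDiff hT hD ?_ hL)
    obtain ⟨q, hq⟩ := soloInformed_census_of_isSparseLanguage hS
    refine ⟨q, fun n => ?_⟩
    obtain ⟨C, hC, hCS⟩ := hq n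
    exact ⟨C, hC, fun u hu hlen => hCS u hu hlen⟩
  · intro h
    by_contra hne
    simp only [not_exists, not_and, not_not] at hne
    refine h {u | u = []} ⊥ (isHard_singleton_nil_of_NP_subset_P fun L hL => hne L hL) bot_mem_P ?_
    exact soloInformed_isSparseLanguage_singleton_nil.mono fun u hu => hu.2 fun h'' => h''

/-- **Density margin for `SAT`.** `P ≠ NP` iff every polynomial-time decision procedure `D` errs on
`SAT` on a **non-sparse** set of instances (`{φ | φ ∈ SAT ↔ φ ∉ D}` is the error set of `D`).
Sharpens `soloInformed_pneNP_iff_sat_infinitely_often_wrong` (infinitely many errors) to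
super-polynomially many errors below infinitely many lengths. [cite: OgiwaraWatanabe1991, main theorem (≤ᵖ_btt-hard sparse sets for NP ⇒ P = NP; theorem number not verified: source not held)] -/
theorem soloInformed_pneNP_iff_sat_errors_not_sparse :
    PneNP ↔ ∀ D ∈ Classes.P, ¬ IsSparseLanguage {φ | φ ∈ SAT ↔ φ ∉ D} := by
  constructor
  · intro h D hD
    exact soloInformed_pneNP_iff_no_P_close_hard_set.1 h SAT D isNPComplete_SAT_holds.isHard hD
  · rw [soloInformed_pneNP_iff_exists_not_mem]
    intro h
    by_contra hne
    simp only [not_exists, not_and, not_not] at hne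
    have hSAT : SAT ∈ Classes.P := hne SAT isNPComplete_SAT_holds.1
    exact h SAT hSAT (isSparseLanguage_zero.mono fun u hu => (iff_not_self hu).elim)

/-- **Density margin, tally form (P. Berman 1978).** `P ≠ NP` iff no Karp-`NP`-hard set is tally
(`T ⊆ 0*`): tally sets are sparse (`IsTally.isSparseLanguage`), and `{ε}` is tally and `NP`-hard when
`P = NP`. [cite: Berman1978, main theorem (tally / polynomial-density NP-complete languages ⇒ P = NP; theorem number not verified: source not held; attribution via Mahaney 1982, held `paper:doi-10-1016-0022-0000-82-90002-2` p.4 "the search method … was introduced by Berman in [3]" and ref. [3] on p.14)] -/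
theorem soloInformed_pneNP_iff_no_tally_hard_set :
    PneNP ↔ ∀ T : Language Bool, IsHard Nondeterministic.NP T → ¬ IsTally T := by
  constructor
  · intro h T hT hTally
    exact soloInformed_pneNP_iff_no_sparse_hard_set.1 h T hT hTally.isSparseLanguage
  · rw [soloInformed_pneNP_iff_exists_not_mem]
    intro h
    by_contra hne
    simp only [not_exists, not_and, not_not] at hne
    refine h _ (isHard_singleton_nil_of_NP_subset_P fun L hL => hne L hL) fun w hw b hb => ?_
    have hw' : w = [] := hw
    subst hw'
    simp at hb

end Summit.PneNP.PneNP.Theorems
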